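import Literature.Analysis.FluidPDE.OnsagerBDSVPerturbation
import Literature.Analysis.ODE.TorusBackwardFlow
import HarnessLib

/-!
# The BDSV perturbation stage: discharge of the backward-flow fact (F₃)

Buckmaster–De Lellis–Székelyhidi–Vicol (BDSV), *Onsager's conjecture for admissible weak
solutions*, CPAM 72 (2019) = arXiv:1701.08678. Of the seven named facts into which
`OnsagerBDSVPerturbation.lean` decomposes the perturbation stage, F₃ `BDSV.backwardFlow_exists`
is the existence of the backward flows of §5.2 ("Define the backward flows `Φ_i` for the velocity
field `v̄_q` as the solution of the transport equation `(∂ₜ + v̄_q·∇) Φ_i = 0`, `Φ_i(x, t_i) = x`";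
App. B: "`Φ(t, ·)` the inverse of the flux `X` of `v` starting at time `t₀` as the identity",
solutions on the torus being "periodic solutions in `ℝ³`"), recorded through the periodic
displacement `D = Φ - id` (`BDSV.FlowDisplacement`). This file PROVES it:
`BDSV.backwardFlow_exists_holds`.

The mathematics is the tree's `Literature.Analysis.ODE.exists_smooth_backwardFlow`
(`Literature/Analysis/ODE/TorusBackwardFlow.lean`, any dimension `d`; Lang 1995, Ch. IV §1: the
time-dependent field as the autonomous suspension `(1, v)` on `ℝ × ℝ^d`, its global flow, joint
smoothness within the slab `[0,T] × ℝ^d`, lattice periodicity by uniqueness, and the chain rule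
along the flow), specialised to `d = Fin 3`; its three conclusions are, field for field, the three
properties of a `BDSV.FlowDisplacement T v t₀`.

Kept in a sibling file so that `OnsagerBDSVPerturbation.lean` and its importers do not acquire
the ODE flow theory in their import closure.

## References

* T. Buckmaster, C. De Lellis, L. Székelyhidi Jr., V. Vicol, *Onsager's conjecture for admissible
  weak solutions*, Comm. Pure Appl. Math. 72 (2019) 229–274 = arXiv:1701.08678, §5.2 (backward
  flows `Φ_i`) and App. B (transport equations). [`BuckmasterEtAl2018`]
* S. Lang, *Differential and Riemannian Manifolds*, GTM 160 (1995), Ch. IV §1. [`Lang1995`]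
-/

open Set

noncomputable section

namespace Literature.Analysis.FluidPDE

namespace BDSV

open FunctionSpaces FunctionSpaces.Torus

/-- **Existence of backward flows — discharge of `BDSV.backwardFlow_exists`** (BDSV §5.2: the
backward flows `Φ_i` of `v̄_q`, "the solution of the transport equation `(∂ₜ + v̄_q·∇) Φ_i = 0`,
`Φ_i(x, t_i) = x`"; App. B: `Φ(t, ·)` is the inverse of the flux of `v` started at `t₀` as the
identity, torus solutions treated as periodic solutions on `ℝ³`): for every `T > 0`, every
velocity field `v` jointly smooth on `[0,T] × T³` and every anchor `t₀ ∈ [0,T]` there is a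
`BDSV.FlowDisplacement T v t₀`, i.e. a jointly smooth periodic displacement `D = Φ - id` with
`D(t₀, ·) = 0` and `∂ₜ D + (v·∇) D + v = 0` on `[0,T] × T³`. Proof: the tree's
`Literature.Analysis.ODE.exists_smooth_backwardFlow` with `d = Fin 3`.
[cite: BuckmasterEtAl2018, §5.2 (Φ_i) and App. B] -/
theorem backwardFlow_exists_holds : backwardFlow_exists := by
  intro T hT v hv t₀ ht₀
  obtain ⟨D, hD, h₀, htr⟩ := Literature.Analysis.ODE.exists_smooth_backwardFlow hT hv ht₀
  exact ⟨⟨D, hD, h₀, htr⟩⟩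

end BDSV

end Literature.Analysis.FluidPDE
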